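import Literature.Analysis.FluidPDE.NSBoundedMildSmoothing
import HarnessLib

/-!
# Pointwise limits in the Oseen integral equation along bounded convergent sequences

Analysis/FluidPDE support file (everything proved, no definitions) for the discharge of
`Literature.Analysis.FluidPDE.KNSS2009_typeI_rate_compactness` (Koch–Nadirashvili–Seregin–Šverák
2009, Lemma 6.1 / Lemma 4.1, arXiv:0709.3599 pp. 8, 11: the locally uniform limit of uniformly
bounded mild solutions is again a mild solution — "a routine consequence of … the decay estimate
(3.8) for the kernel `K_{ijk}`"). The passage to the limit in the two terms of the integral
equation `u(t) = e^{ν(t−s)Δ}u(s) − B^ν_s(u,u)(t)` along a **pointwise** convergent, uniformly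
bounded sequence is dominated convergence:

* `continuous_oseenKernel_args` — the kernel `K(σ, z)[a, b]` is jointly continuous in `(a, b)`
  (a bounded bilinear map, Koch–Tataru's bound (14));
* `tendsto_heatExtension_of_tendsto_of_bound` — `e^{σΔ}f_k(x) → e^{σΔ}f(x)` if `f_k → f`
  pointwise with `‖f_k‖ ≤ M` (domination by `M G_σ`);
* `tendsto_integral_oseenKernel_of_tendsto_of_bound` — the slice integrals
  `∫ K(σ, x−y)[a_k(y), b_k(y)] dy` converge (domination by `C M² (σ + ‖x−y‖²)^{-(d+1)/2}`);
* `tendsto_oseenDuhamel_of_tendsto_of_bound` — `B^ν_s(u_k,u_k)(t)(x) → B^ν_s(u,u)(t)(x)` if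
  `u_k → u` pointwise on `(s, t) × E`, all jointly measurable and bounded by `M` there
  (domination of the time integrand by `C ν^{-1/2} 2M² (t−τ)^{-1/2}`).

## References

* G. Koch, N. Nadirashvili, G. Seregin, V. Šverák, *Liouville theorems for the Navier–Stokes
  equations and applications*, Acta Math. 203 (2009) = arXiv:0709.3599, §3 (3.8), §4 Lemma 4.1,
  §6 Lemma 6.1. [KochNadirashviliSereginSverak2009]
* H. Koch, D. Tataru, Adv. Math. 157 (2001), §3 (14). [KochTataruAdvMath2001]
-/

noncomputable section

open MeasureTheory Set Function Filter TopologicalSpace InnerProductSpace Metric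
open _root_.Topology
open scoped RealInnerProductSpace NNReal ENNReal

namespace Literature.Analysis.FluidPDE

variable {E : Type*} [NormedAddCommGroup E] [InnerProductSpace ℝ E] [FiniteDimensional ℝ E]
  [MeasurableSpace E] [BorelSpace E]

/-! ### Continuity of the kernel in its vector arguments -/

omit [FiniteDimensional ℝ E] [MeasurableSpace E] [BorelSpace E] in
/-- **The Oseen–Koch–Tataru kernel is jointly continuous in its two vector arguments**: for
`σ > 0` and `z` fixed, `(a, b) ↦ K(σ, z)[a, b]` is a bounded bilinear map (bound (14),
`exists_norm_oseenKernel_le`). [cite: KochTataruAdvMath2001, §3 (14)] -/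
theorem continuous_oseenKernel_args {σ : ℝ} (hσ : 0 < σ) (z : E) :
    Continuous fun p : E × E => oseenKernel σ z p.1 p.2 := by
  obtain ⟨C, hC, hK⟩ := exists_norm_oseenKernel_le (E := E)
  have hb : IsBoundedBilinearMap ℝ fun p : E × E => oseenKernel σ z p.1 p.2 :=
    { add_left := fun a a' b => oseenKernel_add_left σ z a a' b
      smul_left := fun c a b => oseenKernel_smul_left σ z c a b
      add_right := fun a b b' => oseenKernel_add_right σ z a b b'
      smul_right := fun c a b => oseenKernel_smul_right σ z c a b
      bound := ⟨C * (σ + ‖z‖ ^ 2) ^ (-(((Module.finrank ℝ E : ℝ) + 1) / 2)), by positivity,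
        fun a b => hK hσ z a b⟩ }
  exact hb.continuous

/-! ### The caloric term -/

variable {F : Type*} [NormedAddCommGroup F] [NormedSpace ℝ F]

/-- **Dominated convergence for the caloric extension**: if `f_k → f` pointwise, the `f_k` are
a.e. strongly measurable and uniformly bounded by `M`, then `e^{σΔ}f_k(x) → e^{σΔ}f(x)` for
`σ > 0` (domination by `M G_σ(y)`). [folklore] -/
theorem tendsto_heatExtension_of_tendsto_of_bound {f : ℕ → E → F} {g : E → F}
    (hf : ∀ k, AEStronglyMeasurable (f k) volume) {M : ℝ} (hM : ∀ k z, ‖f k z‖ ≤ M)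
    (hlim : ∀ z, Tendsto (fun k => f k z) atTop (𝓝 (g z))) {σ : ℝ} (hσ : 0 < σ) (x : E) :
    Tendsto (fun k => UnboundedOperators.heatExtension (f k) σ x) atTop
      (𝓝 (UnboundedOperators.heatExtension g σ x)) := by
  simp only [UnboundedOperators.heatExtension_apply]
  refine tendsto_integral_filter_of_dominated_convergence
    (fun y => UnboundedOperators.heatKernel σ y * M) ?_ ?_
    ((UnboundedOperators.integrable_heatKernel_holds hσ).mul_const M) ?_
  · refine Eventually.of_forall fun k => ?_
    exact (UnboundedOperators.continuous_heatKernel σ).aestronglyMeasurable.smul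
      ((hf k).comp_measurePreserving (Measure.measurePreserving_sub_left volume x))
  · refine Eventually.of_forall fun k => Eventually.of_forall fun y => ?_
    rw [norm_smul, Real.norm_of_nonneg (UnboundedOperators.heatKernel_pos hσ y).le]
    exact mul_le_mul_of_nonneg_left (hM k _) (UnboundedOperators.heatKernel_pos hσ y).le
  · exact Eventually.of_forall fun y => (hlim (x - y)).const_smul _

/-! ### The slices of the Oseen operator -/

/-- **Dominated convergence for a slice of the Oseen operator**: if `a_k → a`, `b_k → b`
pointwise with `‖a_k‖, ‖b_k‖ ≤ M` and all fields a.e. strongly measurable, then for `σ > 0`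
`∫ K(σ, x−y)[a_k(y), b_k(y)] dy → ∫ K(σ, x−y)[a(y), b(y)] dy` (domination by
`C M² (σ + ‖x−y‖²)^{-(d+1)/2}`, Koch–Tataru (14)). [cite: KochTataruAdvMath2001, §3 (14)] -/
theorem tendsto_integral_oseenKernel_of_tendsto_of_bound {σ : ℝ} (hσ : 0 < σ)
    {a b : ℕ → E → E} {a₀ b₀ : E → E}
    (ha : ∀ k, AEStronglyMeasurable (a k) volume) (hb : ∀ k, AEStronglyMeasurable (b k) volume)
    {M : ℝ} (hM : 0 ≤ M) (haM : ∀ k y, ‖a k y‖ ≤ M) (hbM : ∀ k y, ‖b k y‖ ≤ M)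
    (hal : ∀ y, Tendsto (fun k => a k y) atTop (𝓝 (a₀ y)))
    (hbl : ∀ y, Tendsto (fun k => b k y) atTop (𝓝 (b₀ y))) (x : E) :
    Tendsto (fun k => ∫ y, oseenKernel σ (x - y) (a k y) (b k y)) atTop
      (𝓝 (∫ y, oseenKernel σ (x - y) (a₀ y) (b₀ y))) := by
  set d : ℝ := (Module.finrank ℝ E : ℝ) with hd
  obtain ⟨C₀, hC₀, hK⟩ := exists_norm_oseenKernel_le (E := E)
  set e : ℝ := (d + 1) / 2 with he
  have hde : d < 2 * e := by rw [he]; linarith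
  set bound : E → ℝ := fun y => C₀ * (σ + ‖x - y‖ ^ 2) ^ (-e) * M * M with hbound
  refine tendsto_integral_filter_of_dominated_convergence bound ?_ ?_ ?_ ?_
  · refine Eventually.of_forall fun k => ?_
    exact (AEMeasurable.oseenKernel_comp aemeasurable_const
      (measurable_const.sub measurable_id).aemeasurable (ha k).aemeasurable
      (hb k).aemeasurable).aestronglyMeasurable
  · refine Eventually.of_forall fun k => Eventually.of_forall fun y => ?_
    calc ‖oseenKernel σ (x - y) (a k y) (b k y)‖
        ≤ C₀ * (σ + ‖x - y‖ ^ 2) ^ (-e) * ‖a k y‖ * ‖b k y‖ := hK hσ _ _ _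
      _ ≤ C₀ * (σ + ‖x - y‖ ^ 2) ^ (-e) * M * M := by
          gcongr
          · exact haM k y
          · exact hbM k y
  · have h1 : Integrable (fun z : E => (σ + ‖z‖ ^ 2) ^ (-e)) := integrable_add_norm_sq_rpow_neg hde hσ
    have h2 : Integrable (fun y : E => (σ + ‖x - y‖ ^ 2) ^ (-e)) :=
      (Measure.measurePreserving_sub_left volume x).integrable_comp_of_integrable h1
    simpa [hbound, mul_assoc, mul_comm, mul_left_comm] using ((h2.const_mul C₀).mul_const (M * M))
  · refine Eventually.of_forall fun y => ?_
    have hc := continuous_oseenKernel_args hσ (x - y)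
    have hp : Tendsto (fun k => (a k y, b k y)) atTop (𝓝 (a₀ y, b₀ y)) :=
      (hal y).prodMk_nhds (hbl y)
    exact (hc.tendsto _).comp hp

/-! ### The Duhamel term -/

variable {ν s M : ℝ}

/-- **Dominated convergence for the Oseen Duhamel term of bounded fields**: let `u_k`, `u` be
jointly measurable on `(s, t) × E`, the `u_k` bounded by `M` there, with `u_k(τ, y) → u(τ, y)`
for all `τ ∈ (s, t)` and all `y`. Then `B^ν_s(u_k,u_k)(t)(x) → B^ν_s(u,u)(t)(x)` for every `x` (`ν > 0`):
the time integrands converge by `tendsto_integral_oseenKernel_of_tendsto_of_bound` and are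
dominated by `C ν^{-1/2} 2M² (t−τ)^{-1/2}` (KNSS 2009, Lemma 4.1: "a routine consequence of …
the decay estimate for the kernel"). [cite: KochNadirashviliSereginSverak2009, Lemma 4.1 (arXiv:0709.3599 p. 8)] -/
theorem tendsto_oseenDuhamel_of_tendsto_of_bound (hν : 0 < ν) (hM : 0 ≤ M) {t : ℝ} (hst : s < t)
    {u : ℕ → ℝ → E → E} {u₀ : ℝ → E → E}
    (hum : ∀ k, AEStronglyMeasurable (uncurry (u k)) ((volume : Measure (ℝ × E)).restrict (Ioo s t ×ˢ univ)))
    (hu₀m : AEStronglyMeasurable (uncurry u₀) ((volume : Measure (ℝ × E)).restrict (Ioo s t ×ˢ univ)))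
    (huM : ∀ k, ∀ τ ∈ Ioo s t, ∀ y, ‖u k τ y‖ ≤ M)
    (hlim : ∀ τ ∈ Ioo s t, ∀ y, Tendsto (fun k => u k τ y) atTop (𝓝 (u₀ τ y))) (x : E) :
    Tendsto (fun k => oseenDuhamel ν s (u k) (u k) t x) atTop (𝓝 (oseenDuhamel ν s u₀ u₀ t x)) := by
  obtain ⟨C, hC, hCK⟩ := exists_lintegral_enorm_oseenKernel_sub_le (E := E)
  -- measurability on the product measure
  have hprod : ∀ {w : ℝ → E → E},
      AEStronglyMeasurable (uncurry w) ((volume : Measure (ℝ × E)).restrict (Ioo s t ×ˢ univ)) →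
      AEStronglyMeasurable (uncurry w) ((volume.restrict (Ioo s t)).prod (volume : Measure E)) := by
    intro w hw
    rwa [← volume_restrict_prod_univ_eq_prod]
  have hum' := fun k => hprod (hum k)
  have hu₀m' := hprod hu₀m
  -- integrability of the integrands on the product
  have hI : ∀ {w : ℝ → E → E},
      AEStronglyMeasurable (uncurry w) ((volume : Measure (ℝ × E)).restrict (Ioo s t ×ˢ univ)) →
      (∀ τ ∈ Ioo s t, ∀ y, ‖w τ y‖ ≤ M) → Integrable
        (fun p : ℝ × E => oseenKernel (ν * (t - p.1)) (x - p.2) (w p.1 p.2) (w p.1 p.2))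
        ((volume.restrict (Ioo s t)).prod (volume : Measure E)) := by
    intro w hw hwM
    rw [← volume_restrict_prod_univ_eq_prod]
    exact integrable_oseenKernel_duhamel_bounded hν hw hw hM hwM hwM hst le_rfl x
  set K₁ : ℝ := C * ν ^ (-(1 / 2 : ℝ)) * (2 * M * M) with hK₁
  have hK₁0 : 0 ≤ K₁ := by positivity
  -- the slice bound
  have hslice : ∀ {w : ℝ → E → E}, (∀ τ ∈ Ioo s t, ∀ y, ‖w τ y‖ ≤ M) → ∀ τ ∈ Ioo s t,
      ‖∫ y, oseenKernel (ν * (t - τ)) (x - y) (w τ y) (w τ y)‖ ≤ K₁ * (t - τ) ^ (-(1 / 2 : ℝ)) := by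
    intro w hwM τ hτ
    have hσ : 0 < ν * (t - τ) := mul_pos hν (sub_pos.2 hτ.2)
    have hlin := hCK hσ hM hM (a := w τ) (a' := fun _ => 0) (b := w τ) (b' := fun _ => 0)
      (fun _ => by simpa using hM) (hwM τ hτ)
      (Eventually.of_forall fun y => by simpa using hwM τ hτ y)
      (Eventually.of_forall fun y => by simpa using hwM τ hτ y) x
    simp only [oseenKernel_zero_left, sub_zero] at hlin
    calc ‖∫ y, oseenKernel (ν * (t - τ)) (x - y) (w τ y) (w τ y)‖
        ≤ (∫⁻ y, ‖oseenKernel (ν * (t - τ)) (x - y) (w τ y) (w τ y)‖ₑ).toReal := by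
          have h := norm_integral_le_lintegral_norm
            (fun y => oseenKernel (ν * (t - τ)) (x - y) (w τ y) (w τ y)) (μ := volume)
          simpa only [ofReal_norm] using h
      _ ≤ C * (ν * (t - τ)) ^ (-(1 / 2 : ℝ)) * (2 * M * M) :=
          ENNReal.toReal_le_of_le_ofReal (by positivity) hlin
      _ = K₁ * (t - τ) ^ (-(1 / 2 : ℝ)) := by
          rw [hK₁, Real.mul_rpow hν.le (sub_pos.2 hτ.2).le]
          ring
  -- slice measurability for all `k` at a.e. `τ`
  have hsl : ∀ᵐ τ ∂(volume.restrict (Ioo s t)), ∀ k, AEStronglyMeasurable (fun y => u k τ y) volume :=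
    ae_all_iff.2 fun k => (hum' k).prodMk_left
  -- dominated convergence in the time integral
  simp only [oseenDuhamel_apply]
  refine tendsto_integral_filter_of_dominated_convergence (fun τ => K₁ * (t - τ) ^ (-(1 / 2 : ℝ)))
    ?_ ?_ ((integrableOn_Ioo_rpow_neg_half_sub s t).const_mul K₁) ?_
  · exact Eventually.of_forall fun k => (hI (hum k) (huM k)).integral_prod_left.aestronglyMeasurable
  · refine Eventually.of_forall fun k => (ae_restrict_mem measurableSet_Ioo).mono fun τ hτ => ?_
    exact hslice (huM k) τ hτ
  · filter_upwards [hsl, hu₀m'.prodMk_left, ae_restrict_mem measurableSet_Ioo] with τ hτk hτ₀ hτ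
    have hσ : 0 < ν * (t - τ) := mul_pos hν (sub_pos.2 hτ.2)
    exact tendsto_integral_oseenKernel_of_tendsto_of_bound hσ hτk hτk hM
      (fun k y => huM k τ hτ y) (fun k y => huM k τ hτ y) (hlim τ hτ) (hlim τ hτ) x

end Literature.Analysis.FluidPDE

end
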